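import Literature.AnabelianGeometry.AbsoluteAnabelian.AbsTopIII.ReconstructionCor110iiPrimeNaturalProofs
import Literature.AnabelianGeometry.AbsoluteAnabelian.MLFUnitGroupOfGaloisGroup
import HarnessLib

/-!
# [AbsTopIII] Cor. 1.10 (ii)(d): the Kummer image of `kˣ` in `H¹(G_k, μ_Ẑ(G_k))` is an invariant of the
# PROFINITE GROUP `G_k`

Mochizuki, *Topics in Absolute Anabelian Geometry III*, Cor. 1.10 (ii)(d) pp. 42–43 (manuscript pagination, lit key
`paper:url-5493eb38cbb7`): «One constructs the image of the Kummer map `k^× ↪ H¹(G_k, μ_Ẑ(·))` … as the inverse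
image of the subgroup generated by the Frobenius element via the surjection
`H¹(G_k, μ_Ẑ(·)) ⥲ H¹(G_k, μ_Ẑ(G_k)) ⥲ G_k^ab ↠ Ẑ` of (b)» — by a «functorial "group-theoretic" algorithm».

Capstone of the row «Cor110ii-PRIME» (abc-iut layer L4; abc-iut-L4-d1) over the two PROVED readings of
`ReconstructionCor110iiPrime.lean` — (D) `AbsTopIII.cor_1_10_ii'_holds` (abc-iut-L4-d1) and (N)
`AbsTopIII.cor_1_10_i_b_natural_holds` (abc-iut-L4-d3, `ReconstructionCor110iiPrimeNaturalProofs.lean`).  For ANY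
isomorphism `j_k : H¹(G_k, μ_Ẑ(G_k)) ≃+ G_k^{ab}` of (i)(b):
* `Cor110iiPrime.kummerImageOf j_k` — print's construction VERBATIM on the REAL container: the inverse image under
  `j_k` of `𝔄_k⁰ ⊂ G_k^{ab}`, the classes inducing an integral power of Frobenius (the image of the Weil group);
* `mem_kummerImageOf_iff` — if `j_k` is Kummer/reciprocity-compatible (reading (D)) then `kummerImageOf j_k` IS the
  image of the Kummer map `kˣ → H¹(G_k, μ_Ẑ(G_k))` (`kummerGalCyclotome`);
* `galCyclotomeH1Map_mem_kummerImageOf_iff` — if `j_{k₁}, j_{k₂}` are natural under `α : G_{k₁} ≃ₜ* G_{k₂}`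
  (reading (N)) then `H¹(α; μ_Ẑ(α))` carries `kummerImageOf j_{k₁}` exactly onto `kummerImageOf j_{k₂}` ([AbsAnab]
  Prop. 1.2.1 (iii) «`α^{ab}` preserves `Im(K^×)`», abc-iut-L4-d3's `map_range_reciprocity_eq`);
* `AbsTopIII.cor_1_10_ii_d_invariant` — closed form from `cor_1_10_i_b_natural_holds`: there is ONE family of
  subgroups `K_k ⊆ H¹(G_k, μ_Ẑ(G_k))` which ARE the Kummer images of the `kˣ` and are respected by EVERY
  isomorphism of topological groups — the Kummer image is reconstructed "group-theoretically" in the bi-anabelian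
  sense (an invariant of the profinite group `G_k`, geometric or not the isomorphism, cf. Rmk. 1.9.4).
One definition with body + theorems; no named fact, no `sorry`.  HONEST FRAMING: classical local class field theory;
nothing here bears on [IUTchIII] Cor. 3.12 or takes a side.
-/

noncomputable section

open CategoryTheory Function
open Field ValuativeRel

namespace Literature.AnabelianGeometry.AbsoluteAnabelian

open Literature.NumberTheory.GaloisRepresentations

namespace Cor110iiPrime

section Image

variable {k : Type} [Field k] [ValuativeRel k] [TopologicalSpace k] [IsNonarchimedeanLocalField k] [CharZero k]

/-- **The Kummer image read through an isomorphism `j_k : H¹(G_k, μ_Ẑ(G_k)) ≃+ G_k^{ab}`, as in print**: the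
inverse image under `j_k` of `𝔄_k⁰ ⊂ G_k^{ab}`, the classes inducing an integral power of Frobenius (the image of
the Weil group) — «the inverse image of the subgroup generated by the Frobenius element via the surjection … of
(b)». [cite: MochizukiAbsTopIII2015, Cor 1.10 (ii) p.42] -/
def kummerImageOf (j : galCyclotomeH1 (absoluteGaloisGroup k) ≃+ Additive (absoluteGaloisGroupAbelianization k)) :
    AddSubgroup (galCyclotomeH1 (absoluteGaloisGroup k)) :=
  (Subgroup.toAddSubgroup ((weilSubgroup k).map (absGaloisAbProj k))).comap j.toAddMonoidHom

/-- Membership in `kummerImageOf`. [cite: MochizukiAbsTopIII2015, Cor 1.10 (ii) p.42] -/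
theorem mem_kummerImageOf {j : galCyclotomeH1 (absoluteGaloisGroup k) ≃+ Additive (absoluteGaloisGroupAbelianization k)}
    {x : galCyclotomeH1 (absoluteGaloisGroup k)} :
    x ∈ kummerImageOf j ↔ Additive.toMul (j x) ∈ (weilSubgroup k).map (absGaloisAbProj k) :=
  Iff.rfl

/-- **Reading (D) ⇒ `kummerImageOf j_k` IS the image of the Kummer map** `kˣ → H¹(G_k, Ẑ(1)) ⥲ H¹(G_k, μ_Ẑ(G_k))`:
if `j_k ∘ H¹(φ)⁻¹ ∘ κ̂` is a local reciprocity map then `x ∈ j_k⁻¹(𝔄_k⁰)` iff `x` is the Kummer class of some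
`a ∈ kˣ`. [cite: MochizukiAbsTopIII2015, Cor 1.10 (ii) p.42] -/
theorem mem_kummerImageOf_iff {φ : muQZ (absoluteGaloisGroup k) ≃+ Additive (CommGroup.torsion (AlgebraicClosure k)ˣ)}
    {hφ : ∀ (σ : absoluteGaloisGroup k) (x : muQZ (absoluteGaloisGroup k)),
      (((Additive.toMul (φ (σ • x)) : CommGroup.torsion (AlgebraicClosure k)ˣ) :
          (AlgebraicClosure k)ˣ) : AlgebraicClosure k) =
        σ • (((Additive.toMul (φ x) : CommGroup.torsion (AlgebraicClosure k)ˣ) :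
          (AlgebraicClosure k)ˣ) : AlgebraicClosure k)}
    {j : galCyclotomeH1 (absoluteGaloisGroup k) ≃+ Additive (absoluteGaloisGroupAbelianization k)}
    (hj : IsLocalReciprocityMap k (reciprocityOfContainerIso hφ j)) (x : galCyclotomeH1 (absoluteGaloisGroup k)) :
    x ∈ kummerImageOf j ↔ ∃ a : kˣ, kummerGalCyclotome hφ a = Multiplicative.ofAdd x := by
  rw [mem_kummerImageOf, ← hj.range_eq, MonoidHom.mem_range]
  refine exists_congr fun a => ?_
  change Additive.toMul (j (Multiplicative.toAdd (kummerGalCyclotome hφ a))) = Additive.toMul (j x) ↔ _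
  rw [Additive.toMul.injective.eq_iff, j.injective.eq_iff, ← Multiplicative.ofAdd.injective.eq_iff, ofAdd_toAdd]

end Image

section Invariance

variable {k₁ k₂ : Type} [Field k₁] [ValuativeRel k₁] [TopologicalSpace k₁]
  [IsNonarchimedeanLocalField k₁] [CharZero k₁] [Field k₂] [ValuativeRel k₂] [TopologicalSpace k₂]
  [IsNonarchimedeanLocalField k₂] [CharZero k₂]

/-- `α^{ab}` carries `𝔄_{k₁}⁰` onto `𝔄_{k₂}⁰` ([AbsAnab] Prop. 1.2.1 (iii) «`α^{ab}` preserves `Im(K^×)`»,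
abc-iut-L4-d3's `map_range_reciprocity_eq`, read with the reciprocity maps of
`exists_isLocalReciprocityMap_holds`). [cite: MochizukiAbsAnab2004, Prop 1.2.1 (iii) p.10] -/
theorem abelianizationCongr_mem_weilImage_iff (α : absoluteGaloisGroup k₁ ≃ₜ* absoluteGaloisGroup k₂)
    (y : absoluteGaloisGroupAbelianization k₁) :
    abelianizationCongr α y ∈ (weilSubgroup k₂).map (absGaloisAbProj k₂) ↔
      y ∈ (weilSubgroup k₁).map (absGaloisAbProj k₁) := by
  obtain ⟨θ₁, h₁⟩ := exists_isLocalReciprocityMap_holds k₁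
  obtain ⟨θ₂, h₂⟩ := exists_isLocalReciprocityMap_holds k₂
  have hβ : (abelianizationCongr α).toMonoidHom.comp (absGaloisAbProj k₁) =
      (absGaloisAbProj k₂).comp α.toMulEquiv.toMonoidHom :=
    MonoidHom.ext fun σ => abelianizationCongr_mk α σ
  have h := map_range_reciprocity_eq α h₁ h₂ hβ
  rw [← h₁.range_eq, ← h₂.range_eq, ← h, Subgroup.mem_map_equiv, MulEquiv.symm_apply_apply]

/-- **Reading (N) ⇒ the Kummer images correspond under `H¹(α; μ_Ẑ(α))`** for EVERY isomorphism of topological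
groups `α : G_{k₁} ≃ₜ* G_{k₂}` (geometric or not): if `j_{k₂} ∘ H¹(α; μ_Ẑ(α)) = α^{ab} ∘ j_{k₁}` then
`H¹(α; μ_Ẑ(α)) x ∈ j_{k₂}⁻¹(𝔄_{k₂}⁰) ↔ x ∈ j_{k₁}⁻¹(𝔄_{k₁}⁰)`. [cite: MochizukiAbsTopIII2015, Cor 1.10 (ii) p.42] -/
theorem galCyclotomeH1Map_mem_kummerImageOf_iff (α : absoluteGaloisGroup k₁ ≃ₜ* absoluteGaloisGroup k₂)
    {j₁ : galCyclotomeH1 (absoluteGaloisGroup k₁) ≃+ Additive (absoluteGaloisGroupAbelianization k₁)}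
    {j₂ : galCyclotomeH1 (absoluteGaloisGroup k₂) ≃+ Additive (absoluteGaloisGroupAbelianization k₂)}
    (hnat : ∀ x, j₂ (galCyclotomeH1Map α x) = Additive.ofMul (abelianizationCongr α (Additive.toMul (j₁ x))))
    (x : galCyclotomeH1 (absoluteGaloisGroup k₁)) :
    galCyclotomeH1Map α x ∈ kummerImageOf j₂ ↔ x ∈ kummerImageOf j₁ := by
  rw [mem_kummerImageOf, mem_kummerImageOf, hnat x, toMul_ofMul, abelianizationCongr_mem_weilImage_iff]

end Invariance

end Cor110iiPrime

/-- **[AbsTopIII] Cor. 1.10 (ii)(d), bi-anabelian form — PROVED**: there is ONE family of subgroups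
`K_k ⊆ H¹(G_k, μ_Ẑ(G_k))` of the cohomology of abc-iut-L4-t1's GROUP-THEORETIC cyclotome, indexed by the MLFs
`k : Type`, such that (1) `K_k` IS the image of the Kummer map `kˣ ↪ H¹(G_k, Ẑ(1)) ⥲ H¹(G_k, μ_Ẑ(G_k))` (for
some `G_k`-equivariant `φ : μ_{ℚ/ℤ}(G_k) ≅ μ(k̄)`), and (2) for EVERY isomorphism of topological groups
`α : G_{k₁} ≃ₜ* G_{k₂}`, `H¹(α; μ_Ẑ(α)) x ∈ K_{k₂} ↔ x ∈ K_{k₁}` — «one constructs the image of the Kummer map …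
group-theoretically»: the Kummer image is an invariant of the profinite group `G_k`.  From the natural family of
(i)(b) (`AbsTopIII.cor_1_10_i_b_natural_holds`, abc-iut-L4-d3) with `K_k := j_k⁻¹(𝔄_k⁰)` (print's recipe).
[cite: MochizukiAbsTopIII2015, Cor 1.10 (ii) p.42] -/
theorem AbsTopIII.cor_1_10_ii_d_invariant :
    ∃ K : ∀ (k : Type) [Field k] [ValuativeRel k] [TopologicalSpace k] [IsNonarchimedeanLocalField k]
        [CharZero k], AddSubgroup (galCyclotomeH1 (absoluteGaloisGroup k)),
      (∀ (k : Type) [Field k] [ValuativeRel k] [TopologicalSpace k] [IsNonarchimedeanLocalField k]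
        [CharZero k],
        ∃ (φ : muQZ (absoluteGaloisGroup k) ≃+ Additive (CommGroup.torsion (AlgebraicClosure k)ˣ))
          (hφ : ∀ (σ : absoluteGaloisGroup k) (x : muQZ (absoluteGaloisGroup k)),
            (((Additive.toMul (φ (σ • x)) : CommGroup.torsion (AlgebraicClosure k)ˣ) :
                (AlgebraicClosure k)ˣ) : AlgebraicClosure k) =
              σ • (((Additive.toMul (φ x) : CommGroup.torsion (AlgebraicClosure k)ˣ) :
                (AlgebraicClosure k)ˣ) : AlgebraicClosure k)),
          ∀ x, x ∈ K k ↔ ∃ a : kˣ, kummerGalCyclotome hφ a = Multiplicative.ofAdd x) ∧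
      ∀ (k₁ : Type) [Field k₁] [ValuativeRel k₁] [TopologicalSpace k₁] [IsNonarchimedeanLocalField k₁]
        [CharZero k₁] (k₂ : Type) [Field k₂] [ValuativeRel k₂] [TopologicalSpace k₂] [IsNonarchimedeanLocalField k₂]
        [CharZero k₂] (α : absoluteGaloisGroup k₁ ≃ₜ* absoluteGaloisGroup k₂)
        (x : galCyclotomeH1 (absoluteGaloisGroup k₁)), galCyclotomeH1Map α x ∈ K k₂ ↔ x ∈ K k₁ := by
  obtain ⟨j, hD, hN⟩ := AbsTopIII.cor_1_10_i_b_natural_holds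
  refine ⟨fun k _ _ _ _ _ => Cor110iiPrime.kummerImageOf (j k), fun k _ _ _ _ _ => ?_,
    fun k₁ _ _ _ _ _ k₂ _ _ _ _ _ α x =>
      Cor110iiPrime.galCyclotomeH1Map_mem_kummerImageOf_iff α (hN k₁ k₂ α) x⟩
  obtain ⟨φ, hφ, hj⟩ := hD k
  exact ⟨φ, hφ, Cor110iiPrime.mem_kummerImageOf_iff hj⟩

end Literature.AnabelianGeometry.AbsoluteAnabelian
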